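import Literature.NumberTheory.EllipticCurves.YanZhu2026.GreenbergDivisibilityProofs
import Literature.NumberTheory.EllipticCurves.BurungaleCastellaSkinner2025.ProductDivisibilitiesIntegralityProofs
import HarnessLib

/-!
# K2R‴ `SignedLowerDescentFromCommonFrame` (crux stmt-BirchSwinnertonDyer-20213), registered stub (S2)
# `stub_delocalise` — de-localisation of the twist pair's Greenberg PRODUCT inclusion, PROVED

Route-independent `Theorems` file (no `Theses` import) of the cell `bsd-wall`, seat `bsd-wall-sbc-p2`
(prover, skeleton v5 of the crux K2R‴, evidence on stmt-BirchSwinnertonDyer-20213).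

The K1′ package of route `SignedBaseChange` hands, for every Katz frame `(L_K, G, G')` of the twist pair
`(f, f')` over `K` and every structure map `J`, an inclusion of ideals of `R = 𝒪_{ℂ_p}⟦T₂⟧⟦T₁⟧`
(outer variable `T₁` = cyclotomic, inner `T₂` = anticyclotomic)

  `(s) · ch(X_Gr(E/K̃_∞)) · ch(X_Gr(E'/K̃_∞)) ⊆ (G · G')`

UP TO a nonzero CYCLOTOMIC series `s ∈ 𝒪_{ℂ_p}⟦T₁⟧` (placed in the outer variable by `PowerSeries.map C`)
— "in `Λ_L^ur ⊗_{Λ^{cyc,ur}} Frac(Λ^{cyc,ur})`" (Burungale–Skinner–Tian–Wan, arXiv:2409.01350v2, Thm.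
(GMC_r) and the proof of Thm. (KoMC'_lb)). The printed de-localisation step («`μ(𝓛) = 0`. Hence `𝓛` is
coprime to height one prime ideals of `Λ^cyc`, and the divisibility holds in `Λ_L`») is, over the
non-factorial receptacle `𝒪_{ℂ_p}⟦T₂⟧⟦T₁⟧`, the tree's Weierstrass-division cancellation theorem
`Literature.NumberTheory.EllipticCurves.le_span_of_span_map_C_mul_le_of_hasUnitContent_minus`
(file `YanZhu2026/GreenbergDivisibilityProofs.lean`, §B) applied to the product `G · G'`, whose
anticyclotomic projection `(G·G')⁻ = G⁻·G'⁻` has unit content as soon as both factors do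
(`Literature.NumberTheory.EllipticCurves.hasUnitContent_minus_mul`). This file proves the registered stub
(S2) of the crux skeleton v5 VERBATIM; its two companions are (S1) `stub_muZero` (the `μ = 0` input,
Hsieh 2014 Thm. B + the comparison `(G⁻) = (L^BDP)`) and (S3) `stub_transferDescent` (the s-free
Greenberg → signed transfer and descent, BSTW Prop. (Eq) + Prop. (ctl_st)).

References: [BurungaleSkinnerTianWan2024] arXiv:2409.01350v2, proof of Thm. (KoMC'_lb) (corpus
`paper:arxiv-2409.01350` p0075–p0076); [YanZhu2024MainConjNonCM] proof of Thm. 4.2 (2), arXiv:2412.20078v4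
TeX l.1042–1050 (the same cancellation at ordinary `p`); [BurungaleCastellaSkinner2025] proof of Prop.
5.2.1 (`μ` of a product).
-/

namespace Summit.BirchSwinnertonDyer.BirchSwinnertonDyer.Theorems.SignedBaseChangeK2RDelocalisation

open Literature.NumberTheory.EllipticCurves Literature.NumberTheory.EllipticCurves.GreenbergVatsal2000
  Literature.NumberTheory.EllipticCurves.UnrSeries₂

/-- **Registered stub (S2) `stub_delocalise` of K2R‴, PROVED.** In `R = 𝒪_{ℂ_p}⟦T₂⟧⟦T₁⟧`: for a nonzero
cyclotomic series `s ∈ 𝒪_{ℂ_p}⟦T₁⟧`, two series `G, G'` whose anticyclotomic projections `G⁻ = G(T₁ = 0)`,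
`G'⁻` have unit content (`μ(G⁻) = μ(G'⁻) = 0`), and any ideal `I` of `R`, the inclusion
`(s) · I ⊆ (G · G')` forces `I ⊆ (G · G')` — no divisor of `G · G'` comes from the cyclotomic algebra.
[cite: BurungaleSkinnerTianWan2024, proof of Thm. (KoMC'_lb), last paragraph ("μ = 0 … coprime to height one prime ideals of Λ^cyc, and the divisibility holds in Λ_L"), corpus paper:arxiv-2409.01350 p0076]
[cite: YanZhu2024MainConjNonCM, proof of Thm. 4.2 (2) (arXiv:2412.20078v4 TeX l.1042–1050)] -/
theorem stub_delocalise : ∀ (p : ℕ) [Fact p.Prime] (s : PowerSeries (PadicComplexInt p))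
    (G G' : PowerSeries (PowerSeries (PadicComplexInt p))) (I : Ideal (PowerSeries (PowerSeries (PadicComplexInt p)))),
    s ≠ 0 → HasUnitContent (minus G) → HasUnitContent (minus G') →
    Ideal.span {PowerSeries.map (PowerSeries.C (R := PadicComplexInt p)) s} * I ≤ Ideal.span {G * G'} →
    I ≤ Ideal.span {G * G'} := by
  intro p _ s G G' I hs hG hG' h
  exact le_span_of_span_map_C_mul_le_of_hasUnitContent_minus (hasUnitContent_minus_mul hG hG') hs h

/-- **Element form** of the same cancellation for the product: `G·G' ∣ s·c ⇒ G·G' ∣ c` for `s` a nonzero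
cyclotomic series and `μ(G⁻) = μ(G'⁻) = 0`.
[cite: BurungaleSkinnerTianWan2024, proof of Thm. (KoMC'_lb), last paragraph (corpus paper:arxiv-2409.01350 p0076)] -/
theorem dvd_of_dvd_map_C_mul_prod {p : ℕ} [Fact p.Prime] {G G' c : PowerSeries (PowerSeries (PadicComplexInt p))}
    (hG : HasUnitContent (minus G)) (hG' : HasUnitContent (minus G'))
    {s : PowerSeries (PadicComplexInt p)} (hs : s ≠ 0)
    (h : G * G' ∣ PowerSeries.map (PowerSeries.C (R := PadicComplexInt p)) s * c) : G * G' ∣ c :=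
  dvd_of_dvd_map_C_mul_of_hasUnitContent_minus (hasUnitContent_minus_mul hG hG') hs h

end Summit.BirchSwinnertonDyer.BirchSwinnertonDyer.Theorems.SignedBaseChangeK2RDelocalisation
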